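/-
Copyright: the b2b-balaban T⁴-continuum CRUX team, row NE7b leaf lineage `t4-ne7b-formalise-leaf-06` (gen 160). Project licence.
-/
import Summits.QuantumFields.BalabanUV.T4Continuum.Spine.NE7b.SupInductiveStep

/-!
# THE EQUATION-MAP TOWER RE-ENTERS: the NEXT equation map `Q∘Eq∘σ` delivered by `…SupInductiveStep.inductiveStep_eq` (letters on the open
# chart ball `ball 0 ρ`) IS AGAIN an input of `inductiveStep_eq` on every closed ball `closedBall 0 r₂`, `r₂ < ρ`, with linear part
# `A₂ := (Q∘Eq∘σ)′(0)` and smallness `c₂ ≥ C_{P₂}·M⁺·r₂` (the two-point modulus times the radius) — given only the NEXT BLOCKING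
# `(Q₂, Lp₂, P₂, ι₂)` and the NEXT CHART `(T₂, N₂)`; two steps compose and the zeros of the twice-coarsened equation lift to zeros of the
# fine equation at the twice-transported background (row NE7b, node U5c; SIS BY NAME twice; [folklore]; any Banach currency)

Cell `pub-balaban`, sub-cell `t4`, spine estimate NE7b (`T4WeightBudget.RelWeightBound`; the cell's OWN estimate — NOT PRINTED in
[Bałaban 1983–89], NOT PROVED).  Crux-route work under `Spine/NE7b/` by a row leaf (`t4-ne7b-formalise-leaf-06` gen 160) under FREEZE
(0)'s crux-prover clause — the equation-map twin of this lineage's `…HardStepTowerTwoSteps` (HSTT, Hilbert currency); NOTHING of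
Bałaban's is named as a Lean object, valued or asserted; no `T4Continuum/Support` leaf typed; no `def`; zero `sorry`.  Import: this
lineage's `…SupInductiveStep` (SIS) only (through it HSCR ∕ HSBD ∕ HSBDM).

WHY (located).  SIS is ONE step: scale-`k` letters on `closedBall 0 r` ⟹ branch `σ` + the next equation map `Eq⁺ := Q∘Eq∘σ` with
`C¹` letters on the OPEN ball `ball 0 ρ`, `ρ = (N⁻¹ − c)r`.  Whether the induction CLOSES IN SHAPE — whether `Eq⁺`, restricted to a
closed ball `closedBall 0 r₂`, `r₂ < ρ`, is again an input of `inductiveStep_eq` at scale `k + 1` — is the content of this file: it is,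
with the next linear part `A₂ := Eq⁺′(0)`, the next bound `B₂ := ‖Q‖BK₁`, the next modulus `M₂ := ‖Q‖(M₃K₁K₁ + B·K₁²C_PM₃K₁)` and the
next smallness `c₂ ≥ C_{P₂}·M₂·r₂` (HSIS `nextModulus_on_closedBall`'s shape: on `closedBall 0 r₂`, `‖P₂∘(Eq⁺′ w − Eq⁺′ 0)‖ ≤
C_{P₂}M₂‖w‖ ≤ C_{P₂}M₂r₂`).  What does NOT close in shape is honest and displayed: the NEXT CHART `T₂ : F ≃L F₂ × K₂` reading
`(Q₂, P₂∘A₂)` with `‖T₂⁻¹‖ ≤ N₂` (for the free part ASE at the next side is the candidate; the interacting correction is the OWNER's (61)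
road) and the NUMERICAL non-degradation of `(N, c, r, B, M₃)` along the tower ((A3)).  No rescaling appears: in the `ℓ^∞(ℤ^d)` picture the
coarse lattice is again `ℤ^d` and the charts are taken at the composite side (ASE «every side, the same `N_∞`»).

WHAT IS PROVED ([folklore]; `E F F₂ K K₂` real normed spaces; `E`, `F` complete and nontrivial):
* §1 `norm_comp_sub_le_of_modulus` (`‖P₂∘(X w − X 0)‖ ≤ C·M·r₂` on `closedBall 0 r₂` from a two-point modulus on a larger open ball),
  **`nextStep_of_letters_eq`** — ABSTRACT RE-ENTRY: an equation map `Eq₂ : F → F` with `Eq₂ 0 = 0`, derivative `Eq₂′`, bound `B₂`,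
  modulus `M₂` on `ball 0 ρ`; a radius `0 ≤ r₂ < ρ`; the next blocking `(Q₂, Lp₂, P₂, ι₂)` (`ι₂(P₂ h) = h − Lp₂(Q₂ h)`, `‖P₂‖ ≤ C_{P₂}`);
  the next chart `T₂ h = (Q₂ h, P₂(Eq₂′ 0 h))`, `‖T₂⁻¹ y‖ ≤ N₂‖y‖`; numbers `C_{P₂}M₂r₂ ≤ c₂ < N₂⁻¹` ⟹ `inductiveStep_eq`'s CONCLUSION
  at scale `k + 1` (branch `σ₂`, lift identity, derivative letters, the next-next equation map `Q₂∘Eq₂∘σ₂`, zeros lift).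
* §2 **`twoSteps_eq`** — THE COMPOSITION: `inductiveStep_eq`'s scale-`k` hypotheses VERBATIM + the scale-`(k+1)` data of §1 for
  `Eq₂ := Q∘Eq∘σ₁` (with `B₂`, `M₂` the step's explicit constants and the next chart reading `(Q₂, P₂∘Q∘Eq′(0)∘S)` for every linear
  section `S` of `Q` killed by `P∘Eq′(0)` — `Dσ₁(0)` is one) ⟹ `∃ σ₁ σ₂`,
  `σ₁ 0 = 0`, `σ₂ 0 = 0`, `σ₂`'s branch letters on `closedBall 0 ((N₂⁻¹ − c₂)r₂)` (`Q₂(σ₂ v) = v`, `P₂(Q(Eq(σ₁(σ₂ v)))) = 0`, Lipschitz),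
  and THE TWO-STEP LIFT: `Q₂(Q(Eq(σ₁(σ₂ v)))) = 0 → Eq(σ₁(σ₂ v)) = 0` — a zero of the twice-coarsened equation is a zero of the fine
  equation at the twice-transported background.
* §3 toy: the smallness arithmetic `C·M·r₂ ≤ c₂` (`example`).

NOT HERE (honest): `T₂`, `N₂` BY VALUE (ASE at the next side for the free part; (61)'s interacting chart); the `n`-step tower over `ℕ`
(two steps exhibit the re-entry, as HSTT); rescaling (none needed on `ℤ^d`; print's `L`-blocking lives in the instance); the `ℓ^∞`
instance; (A3) ∕ (A1c); NC-NE7b-α UNRULED; anything of Bałaban's.  BY-NAME EFFECT ON THE WALL: NONE.  NE7b NOT PRINTED ∕ NOT PROVED;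
spine PROVED 0∕9; rung (B)+1 on a FINITE torus — NOT infinite volume, NOT the mass gap, NOT Clay.  HONEST DEPENDENCY: continuum YM on
T⁴ ⇐ BetaPertH ∧ nine spine estimates (0∕9 proved); BetaPertH ⇐ (D1) ∧ (D4) ∧ CAP+tail; G-an2-4 gates asym, D1 and NE2∕3∕4.
-/

set_option autoImplicit false

noncomputable section

namespace Summit.QuantumFields.BalabanUV.T4Continuum.NE7b.SupEquationTwoSteps

open Set Metric Function
open scoped NNReal
open Summit.QuantumFields.BalabanUV.T4Continuum.NE7b

variable {E F F₂ K K₂ : Type*} [NormedAddCommGroup E] [NormedSpace ℝ E] [NormedAddCommGroup F] [NormedSpace ℝ F]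
  [NormedAddCommGroup F₂] [NormedSpace ℝ F₂] [NormedAddCommGroup K] [NormedSpace ℝ K] [NormedAddCommGroup K₂] [NormedSpace ℝ K₂]

/-! ## §1. Re-entry: the next equation map's letters on `ball 0 ρ` are SIS inputs on every `closedBall 0 r₂`, `r₂ < ρ` -/

omit [NormedSpace ℝ F] in
/-- The smallness letter from the modulus: a two-point modulus `‖X w − X w′‖ ≤ M‖w − w′‖` on `ball 0 ρ` and `‖P₂‖ ≤ C` give, on
`closedBall 0 r₂` with `r₂ < ρ`, `‖P₂∘(X w − X 0)‖ ≤ C·M·r₂`. [folklore] -/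
theorem norm_comp_sub_le_of_modulus [NormedSpace ℝ F] {X : F → F →L[ℝ] F} {ρ r₂ M C : ℝ} (P₂ : F →L[ℝ] K₂) (hC : ‖P₂‖ ≤ C)
    (hM : 0 ≤ M) (hr₂ : r₂ < ρ) (hX : ∀ w ∈ ball (0 : F) ρ, ∀ w' ∈ ball (0 : F) ρ, ‖X w - X w'‖ ≤ M * ‖w - w'‖)
    {w : F} (hw : w ∈ closedBall (0 : F) r₂) : ‖P₂.comp (X w - X 0)‖ ≤ C * M * r₂ := by
  have hwρ : w ∈ ball (0 : F) ρ := closedBall_subset_ball hr₂ hw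
  have hρ : 0 < ρ := lt_of_le_of_lt (le_trans dist_nonneg (mem_closedBall.1 hw)) hr₂
  have h0 : (0 : F) ∈ ball (0 : F) ρ := mem_ball_self hρ
  have hwn : ‖w‖ ≤ r₂ := by rwa [mem_closedBall, dist_zero_right] at hw
  have hC0 : 0 ≤ C := (norm_nonneg _).trans hC
  calc ‖P₂.comp (X w - X 0)‖ ≤ ‖P₂‖ * ‖X w - X 0‖ := ContinuousLinearMap.opNorm_comp_le _ _
    _ ≤ C * (M * ‖w - 0‖) := mul_le_mul hC (hX w hwρ 0 h0) (norm_nonneg _) hC0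
    _ ≤ C * (M * r₂) := by rw [sub_zero]; exact mul_le_mul_of_nonneg_left (mul_le_mul_of_nonneg_left hwn hM) hC0
    _ = C * M * r₂ := by ring

/-- **ABSTRACT RE-ENTRY**: an equation map `Eq₂` on `F` with `Eq₂ 0 = 0` and `C¹` letters (`HasFDerivAt`, bound `B₂`, modulus `M₂`) on the
OPEN ball `ball 0 ρ` — the shape SIS delivers for `Q∘Eq∘σ` — together with a radius `0 ≤ r₂ < ρ`, the next blocking `(Q₂, Lp₂, P₂, ι₂)`, the
next chart `T₂` reading `(Q₂, P₂∘Eq₂′(0))` with `‖T₂⁻¹ y‖ ≤ N₂‖y‖`, and numbers `C_{P₂}·M₂·r₂ ≤ c₂ < N₂⁻¹` satisfies `inductiveStep_eq`'s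
hypotheses at scale `k + 1` on `closedBall 0 r₂`; here its conclusion. [folklore] -/
theorem nextStep_of_letters_eq [CompleteSpace F] [Nontrivial F]
    {Eq₂ : F → F} {Eq₂' : F → F →L[ℝ] F} (hE₂0 : Eq₂ 0 = 0) {ρ B₂ M₂ : ℝ} (hM₂ : 0 ≤ M₂)
    (hE₂ : ∀ w ∈ ball (0 : F) ρ, HasFDerivAt Eq₂ (Eq₂' w) w)
    (hB₂ : ∀ w ∈ ball (0 : F) ρ, ‖Eq₂' w‖ ≤ B₂)
    (hM₂' : ∀ w ∈ ball (0 : F) ρ, ∀ w' ∈ ball (0 : F) ρ, ‖Eq₂' w - Eq₂' w'‖ ≤ M₂ * ‖w - w'‖)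
    {r₂ : ℝ} (hr₂0 : 0 ≤ r₂) (hr₂ : r₂ < ρ)
    (Q₂ : F →L[ℝ] F₂) (Lp₂ : F₂ →L[ℝ] F) (P₂ : F →L[ℝ] K₂) (ι₂ : K₂ →L[ℝ] F) (hPι₂ : ∀ h, ι₂ (P₂ h) = h - Lp₂ (Q₂ h))
    {CP₂ : ℝ} (hCP₂ : ‖P₂‖ ≤ CP₂)
    (T₂ : F ≃L[ℝ] F₂ × K₂) (hT₂ : ∀ h, T₂ h = (Q₂ h, P₂ (Eq₂' 0 h))) {N₂ c₂ : ℝ≥0}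
    (hN₂ : ∀ y : F₂ × K₂, ‖T₂.symm y‖ ≤ N₂ * ‖y‖) (hcN₂ : c₂ < N₂⁻¹) (hc₂ : CP₂ * M₂ * r₂ ≤ (c₂ : ℝ)) :
    ∃ σ₂ : F₂ → F, σ₂ 0 = 0 ∧
      (∀ v ∈ closedBall (0 : F₂) (((N₂ : ℝ)⁻¹ - c₂) * r₂),
        σ₂ v ∈ closedBall (0 : F) r₂ ∧ Q₂ (σ₂ v) = v ∧ P₂ (Eq₂ (σ₂ v)) = 0 ∧ Eq₂ (σ₂ v) = Lp₂ (Q₂ (Eq₂ (σ₂ v)))) ∧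
      LipschitzOnWith (N₂⁻¹ - c₂)⁻¹ σ₂ (closedBall (0 : F₂) (((N₂ : ℝ)⁻¹ - c₂) * r₂)) ∧
      (∀ x ∈ closedBall (0 : F) r₂, P₂ (Eq₂ x) = 0 → σ₂ (Q₂ x) = x) ∧
      (∀ v ∈ ball (0 : F₂) (((N₂ : ℝ)⁻¹ - c₂) * r₂), DifferentiableAt ℝ σ₂ v ∧ ‖fderiv ℝ σ₂ v‖ ≤ ((N₂ : ℝ)⁻¹ - c₂)⁻¹ ∧
        Q₂.comp (fderiv ℝ σ₂ v) = ContinuousLinearMap.id ℝ F₂ ∧ ∀ k, P₂ (Eq₂' (σ₂ v) (fderiv ℝ σ₂ v k)) = 0) ∧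
      (∀ v ∈ ball (0 : F₂) (((N₂ : ℝ)⁻¹ - c₂) * r₂),
        HasFDerivAt (fun v => Q₂ (Eq₂ (σ₂ v))) (Q₂.comp ((Eq₂' (σ₂ v)).comp (fderiv ℝ σ₂ v))) v ∧
        ‖Q₂.comp ((Eq₂' (σ₂ v)).comp (fderiv ℝ σ₂ v))‖ ≤ ‖Q₂‖ * B₂ * ((N₂ : ℝ)⁻¹ - c₂)⁻¹) ∧
      (∀ v ∈ closedBall (0 : F₂) (((N₂ : ℝ)⁻¹ - c₂) * r₂), Q₂ (Eq₂ (σ₂ v)) = 0 → Eq₂ (σ₂ v) = 0) := by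
  have hsub : closedBall (0 : F) r₂ ⊆ ball (0 : F) ρ := closedBall_subset_ball hr₂
  obtain ⟨σ₂, h0, ha, hlip, huniq, hb, -, -, hc, -, hd⟩ :=
    SupInductiveStep.inductiveStep_eq Q₂ Lp₂ P₂ ι₂ hPι₂ hCP₂ hE₂0 hr₂0 (fun x hx => hE₂ x (hsub hx)) (fun x hx => hB₂ x (hsub hx)) hM₂
      (fun x hx x' hx' => hM₂' x (hsub hx) x' (hsub hx')) (Eq₂' 0) T₂ hT₂ hN₂ hcN₂
      (fun x hx => (norm_comp_sub_le_of_modulus P₂ hCP₂ hM₂ hr₂ hM₂' hx).trans hc₂)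
  exact ⟨σ₂, h0, ha, hlip, huniq, hb, hc, hd⟩

/-! ## §2. Two steps compose; the two-step lift -/

/-- **TWO STEPS OF THE EQUATION-MAP TOWER.**  `inductiveStep_eq`'s scale-`k` hypotheses VERBATIM (on `E`, radius `r`, chart `(T, N)`,
smallness `c`), and the scale-`(k+1)` data: a radius `0 ≤ r₂ < ρ := (N⁻¹ − c)r`, the next blocking `(Q₂, Lp₂, P₂, ι₂)` on `F` with
`‖P₂‖ ≤ C_{P₂}`, the next chart `T₂` reading `(Q₂, P₂∘A₂)` where `A₂ := Q∘Eq′(0)∘S` for EVERY linear section `S` of `Q` killed by `P∘Eq′(0)`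
(the UNIVERSAL form, as HSTT's coercivity hypothesis: `Dσ₁(0)` is such a section by SIS (b), and all of them coincide by the chart),
`‖T₂⁻¹ y‖ ≤ N₂‖y‖`, and numbers
`C_{P₂}·M₂·r₂ ≤ c₂ < N₂⁻¹` with `M₂ := ‖Q‖(M₃K₁K₁ + B(K₁²C_PM₃K₁))` ⟹ two branches `σ₁ : F → E`, `σ₂ : F₂ → F`, both through `0`, the
second step's branch letters for `Eq₂ := Q∘Eq∘σ₁`, and THE TWO-STEP LIFT `Q₂(Q(Eq(σ₁(σ₂ v)))) = 0 → Eq(σ₁(σ₂ v)) = 0`. [folklore] -/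
theorem twoSteps_eq [CompleteSpace E] [Nontrivial E] [CompleteSpace F] [Nontrivial F]
    (Q : E →L[ℝ] F) (Lp : F →L[ℝ] E) (P : E →L[ℝ] K) (ι : K →L[ℝ] E)
    (hPι : ∀ h, ι (P h) = h - Lp (Q h)) {CP : ℝ} (hCP : ‖P‖ ≤ CP)
    {Eq : E → E} {Eq' : E → E →L[ℝ] E} (hE0 : Eq 0 = 0) {r : ℝ} (hr : 0 ≤ r)
    (hE : ∀ x ∈ closedBall (0 : E) r, HasFDerivAt Eq (Eq' x) x)
    {B M₃ : ℝ} (hB : ∀ x ∈ closedBall (0 : E) r, ‖Eq' x‖ ≤ B) (hM₃ : 0 ≤ M₃)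
    (hM : ∀ x ∈ closedBall (0 : E) r, ∀ x' ∈ closedBall (0 : E) r, ‖Eq' x - Eq' x'‖ ≤ M₃ * ‖x - x'‖)
    (A : E →L[ℝ] E) (T : E ≃L[ℝ] F × K) (hT : ∀ h, T h = (Q h, P (A h))) {N c : ℝ≥0}
    (hN : ∀ y : F × K, ‖T.symm y‖ ≤ N * ‖y‖) (hcN : c < N⁻¹)
    (hc : ∀ x ∈ closedBall (0 : E) r, ‖P.comp (Eq' x - A)‖ ≤ c)
    -- scale `k + 1`
    {r₂ : ℝ} (hr₂0 : 0 ≤ r₂) (hr₂ : r₂ < ((N : ℝ)⁻¹ - c) * r)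
    (Q₂ : F →L[ℝ] F₂) (Lp₂ : F₂ →L[ℝ] F) (P₂ : F →L[ℝ] K₂) (ι₂ : K₂ →L[ℝ] F) (hPι₂ : ∀ h, ι₂ (P₂ h) = h - Lp₂ (Q₂ h))
    {CP₂ : ℝ} (hCP₂ : ‖P₂‖ ≤ CP₂) (T₂ : F ≃L[ℝ] F₂ × K₂) {N₂ c₂ : ℝ≥0}
    (hT₂ : ∀ S : F →L[ℝ] E, Q.comp S = ContinuousLinearMap.id ℝ F → (∀ k, P (Eq' 0 (S k)) = 0) →
      ∀ h, T₂ h = (Q₂ h, P₂ (Q (Eq' 0 (S h)))))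
    (hN₂ : ∀ y : F₂ × K₂, ‖T₂.symm y‖ ≤ N₂ * ‖y‖) (hcN₂ : c₂ < N₂⁻¹)
    (hc₂ : CP₂ * (‖Q‖ * (M₃ * ((N : ℝ)⁻¹ - c)⁻¹ * ((N : ℝ)⁻¹ - c)⁻¹ +
      B * ((((N : ℝ)⁻¹ - c)⁻¹) ^ 2 * (CP * M₃) * ((N : ℝ)⁻¹ - c)⁻¹))) * r₂ ≤ (c₂ : ℝ)) :
    ∃ (σ₁ : F → E) (σ₂ : F₂ → F), σ₁ 0 = 0 ∧ σ₂ 0 = 0 ∧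
      (∀ w ∈ closedBall (0 : F) (((N : ℝ)⁻¹ - c) * r),
        σ₁ w ∈ closedBall (0 : E) r ∧ Q (σ₁ w) = w ∧ P (Eq (σ₁ w)) = 0 ∧ Eq (σ₁ w) = Lp (Q (Eq (σ₁ w)))) ∧
      (∀ v ∈ closedBall (0 : F₂) (((N₂ : ℝ)⁻¹ - c₂) * r₂),
        σ₂ v ∈ closedBall (0 : F) r₂ ∧ Q₂ (σ₂ v) = v ∧ P₂ (Q (Eq (σ₁ (σ₂ v)))) = 0 ∧
          Q (Eq (σ₁ (σ₂ v))) = Lp₂ (Q₂ (Q (Eq (σ₁ (σ₂ v)))))) ∧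
      LipschitzOnWith (N₂⁻¹ - c₂)⁻¹ σ₂ (closedBall (0 : F₂) (((N₂ : ℝ)⁻¹ - c₂) * r₂)) ∧
      (∀ v ∈ closedBall (0 : F₂) (((N₂ : ℝ)⁻¹ - c₂) * r₂), Q₂ (Q (Eq (σ₁ (σ₂ v)))) = 0 → Eq (σ₁ (σ₂ v)) = 0) := by
  -- step `k`
  obtain ⟨σ₁, h10, h1a, h1lip, -, h1b, h1Λ, h1c0, h1c, h1cc, h1d⟩ :=
    SupInductiveStep.inductiveStep_eq Q Lp P ι hPι hCP hE0 hr hE hB hM₃ hM A T hT hN hcN hc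
  -- constants
  have hc' : (c : ℝ) < (N : ℝ)⁻¹ := by
    have h := NNReal.coe_lt_coe.2 hcN
    rwa [NNReal.coe_inv] at h
  have hK0 : (0 : ℝ) ≤ ((N : ℝ)⁻¹ - c)⁻¹ := inv_nonneg.2 (sub_pos.2 hc').le
  have hCP0 : 0 ≤ CP := (norm_nonneg P).trans hCP
  have hρpos : 0 < ((N : ℝ)⁻¹ - c) * r := lt_of_le_of_lt hr₂0 hr₂
  have h0ball : (0 : F) ∈ ball (0 : F) (((N : ℝ)⁻¹ - c) * r) := mem_ball_self hρpos
  have hB0 : 0 ≤ B := by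
    obtain ⟨hmem, -, -, -⟩ := h1a 0 (ball_subset_closedBall h0ball)
    exact (norm_nonneg _).trans (hB _ hmem)
  have hM₂ : 0 ≤ ‖Q‖ * (M₃ * ((N : ℝ)⁻¹ - c)⁻¹ * ((N : ℝ)⁻¹ - c)⁻¹ +
      B * ((((N : ℝ)⁻¹ - c)⁻¹) ^ 2 * (CP * M₃) * ((N : ℝ)⁻¹ - c)⁻¹)) := by positivity
  -- the next chart reads `(Q₂, P₂ ∘ Eq₂′(0))`, `Eq₂′(0) = Q∘Eq′(0)∘Dσ₁(0)`; `Dσ₁(0)` is a linear section of `Q` killed by `P∘Eq′(0)`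
  obtain ⟨-, -, hQS, hPS⟩ := h1b 0 h0ball
  rw [h10] at hPS
  have hT₂' : ∀ h, T₂ h = (Q₂ h, P₂ ((Q.comp ((Eq' (σ₁ 0)).comp (fderiv ℝ σ₁ 0))) h)) := fun h => by
    rw [hT₂ (fderiv ℝ σ₁ 0) hQS hPS h, h10]; rfl
  -- step `k + 1` = §1 with `Eq₂ := Q ∘ Eq ∘ σ₁`
  obtain ⟨σ₂, h20, h2a, h2lip, -, -, -, h2d⟩ :=
    nextStep_of_letters_eq (Eq₂ := fun w => Q (Eq (σ₁ w))) (Eq₂' := fun w => Q.comp ((Eq' (σ₁ w)).comp (fderiv ℝ σ₁ w)))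
      h1c0 hM₂ (fun w hw => (h1c w hw).1) (fun w hw => (h1c w hw).2) h1cc hr₂0 hr₂ Q₂ Lp₂ P₂ ι₂ hPι₂ hCP₂ T₂ hT₂' hN₂ hcN₂ hc₂
  refine ⟨σ₁, σ₂, h10, h20, h1a, fun v hv => ?_, h2lip, fun v hv h0 => ?_⟩
  · obtain ⟨hm, hq, hp, hl⟩ := h2a v hv
    exact ⟨hm, hq, hp, hl⟩
  · -- the two-step lift: `Q₂(Eq₂(σ₂ v)) = 0 ⟹ Eq₂(σ₂ v) = 0`, i.e. `Q(Eq(σ₁(σ₂ v))) = 0 ⟹ Eq(σ₁(σ₂ v)) = 0`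
    have h2 : Q (Eq (σ₁ (σ₂ v))) = 0 := h2d v hv h0
    have hmem : σ₂ v ∈ closedBall (0 : F) (((N : ℝ)⁻¹ - c) * r) :=
      closedBall_subset_closedBall hr₂.le (h2a v hv).1
    exact h1d (σ₂ v) hmem h2

/-! ## §3. Toy -/

/-- Toy: the next smallness arithmetic — with `C_{P₂} = 2`, `M₂ = 3`, radius `r₂ = 1∕12`, the smallness `c₂ = 1∕2` suffices. -/
example : (2 : ℝ) * 3 * (1 / 12) ≤ 1 / 2 := by norm_num

end Summit.QuantumFields.BalabanUV.T4Continuum.NE7b.SupEquationTwoSteps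

end
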